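import Summits.KontsevichZagierPeriods.Zeta5Search.Certificates.RayC1KernelClassCWLR4P0
import HarnessLib

/-!
# ζ(5) search — certificates: the CLASS-LAW WINDOW LIST BELOW θ = 1 of the ray RayC1, consumption round R4 (TYPER g17)

HONEST FRAMING: systematic search; no irrationality claim unless certified.  `p`-adic bookkeeping; nothing about `ζ(5)`.

OUR work (Summit side; typer seat, generation 17; generator `HOME/pub-zeta5-typer-g17/gen/gen_classround.py C1 … R4`).  The list
`c1CWLR4` of the 1 PROVED windows consumed in round R4 (= the landed adapter chunks `c1CWLR4_0`)
and `c1CWLR4_holdsLow : ∀ c ∈ c1CWLR4, c.HoldsLow` — the hypothesis of `soundChecker_lowClass` for this round's table.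
-/

noncomputable section

namespace Summit.KontsevichZagierPeriods.Zeta5Search.RayC1

open Summit.KontsevichZagierPeriods.Zeta5Search.RayKernel

/-- **The class-law window list below θ = 1 of round R4.** -/
def c1CWLR4 : List CWin := c1CWLR4_0

/-- **Every window holds** (the landed window theorems, by name). -/
theorem c1CWLR4_holdsLow : ∀ c ∈ c1CWLR4, c.HoldsLow := by
  intro c hc
  simp only [c1CWLR4] at hc
  exact c1CWLR4_0_holdsLow c hc

end Summit.KontsevichZagierPeriods.Zeta5Search.RayC1
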